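import Mathlib
import Literature.Probability.Percolation.StochasticDomination
import HarnessLib

/-!
# Domination by product measures (Liggett–Schonmann–Stacey 1997) — proofs

Topic `Literature/Probability/Percolation`. This file discharges the named fact
`Literature.Probability.Percolation.LiggettSchonmannStacey1997_dominatesProduct` of
`StochasticDomination.lean` (Liggett–Schonmann–Stacey, *Domination by product measures*,
Ann. Probab. 25 (1997) 71–95, Theorem 0.0 (i)–(ii) = Theorem 1.3 + Corollary 1.4, in the corollary
form used by static renormalisation: an `M`-dependent family of events on `ℤ^d` with marginals
`≥ 1 - δ(d, M, ρ)` dominates, on increasing measurable events of the random set, every independent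
family with marginals `≤ ρ`), following the printed proof of §1 (pp. 76–82):

* **Lemma 1.1** (sequential criterion; the paper omits the proof, "a reasonably standard use of
  the coupling technique … step-by-step construction", referring to Russo 1982, Lemma 1): if
  `P(Z_{n} = 1 | Z_0 = ε_0, …, Z_{n-1} = ε_{n-1}) ≥ ρ_n` for all histories, then `(Z_n)` dominates
  the product field with densities `ρ_n`. We realise the step-by-step construction on
  `Ω₁ × [0,1]^ℕ` (`LSS.V`, thresholds `LSS.θ`): `V_n = {Z_n ∧ U_n < θ_n(history)}` with
  `θ_n(ε) = ρ_n P(A_ε)/P(Z_n ∩ A_ε)`; then `P(⋂_{n∈G} V_n) = ∏_{n∈G} ρ_n` by induction on `max G`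
  and a partition into history atoms (`LSS.real_iInter_V`), the laws of `{n | V_n}` and of an
  independent family `{n | Y_n}` with `P'(Y_n) = ρ_n` agree on the π-system `{s | G ⊆ s}` and hence
  coincide (`LSS.measure_set_ext`), and `V_n ⊆ Z_n` gives the inequality on increasing events
  (`LSS.seqCoupling`). *Deviation:* the paper proves the finite-dimensional statement and passes
  to the limit ("true for any finite subset `F` of `S`, and hence `ν ≥ π`"); coupling directly on
  the infinite product (`Measure.infinitePi`) avoids the weak limit. Strassen's theorem
  (their Lemma 1.0) is not needed in this direction.
* **Proposition 1.2** (`LSS.prop12`, the Lovász-local-lemma-type induction on the number of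
  conditioning sites): with `Z_s = X_s Y_s`, `(Y_s)` an independent Bernoulli(`r`) family
  independent of `(X_s)`, `P(X_{s₀} = 0 | Z-atom) ≤ 1 - α`. We prove it in "atom form"
  `P(X_{s₀}ᶜ ∩ A) ≤ (1-α) P(A)` (no conditional probabilities, no division), with the abstract
  hypotheses (h1) `P(X_{s₀}ᶜ ∩ A_M) ≤ q P(A_M)` for atoms over non-neighbours `M` and (h2)/(h3)
  "`Y_m` is independent of everything else with probability `r`", which are then verified on the
  product space `Ω × [0,1]^ℕ` from the dependence-graph hypothesis by a π-system argument
  (`LSS.indep_prodσ`). *Deviation:* we bound the denominator of (1.6) by `min(αr, 1-r)^{|N|}`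
  with `|N| ≤ Δ` the full neighbourhood (self included) instead of `(1-r)^{|N₀|} α^{|N₁|}` with
  `|N₀| + |N₁| ≤ Δ - 1`; accordingly our sufficient condition is `q ≤ (1-α) min(αr,1-r)^Δ` in
  place of (1.2)–(1.3). This loses only constants, which Theorem 0.0 (i)–(ii) does not record,
  and makes the clever ordering of Theorem 1.3's proof unnecessary (any enumeration works).
* **Theorem 1.3** on `ℕ` with an abstract dependence neighbourhood `bad : ℕ → Finset ℕ` of size
  `≤ Δ` (`LSS.lss_nat`), and the transfer to `ℤ^d` (`M`-dependence ⇒ dependence graph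
  `‖x - y‖_∞ ≤ M`, `Δ = (2M+1)^d`; re-indexing along an injection `ℤ^d ↪ ℕ`, padding with sure /
  impossible events) with the explicit parameters `ρ₀ = max ρ ½`, `r = (1+ρ₀)/2`, `α = ρ₀/r`,
  `δ = (1-α) min(ρ₀, 1-r)^Δ` (`LiggettSchonmannStacey1997_dominatesProduct_holds`).

Everything except the final theorem lives in the internal namespace
`Literature.Probability.Percolation.LSS`.

## References

* T. M. Liggett, R. H. Schonmann, A. M. Stacey, *Domination by product measures*, Ann. Probab.
  25 (1997) 71–95, §1: Lemma 1.1 p. 79, Proposition 1.2 pp. 79–81, Theorem 1.3 pp. 81–82,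
  Corollary 1.4 p. 82, Theorem 0.0 pp. 75–76 [LiggettSchonmannStacey1997].
* G. Grimmett, *Percolation*, 2nd ed., Springer 1999, §7.4, Theorem (7.65) (textbook account)
  [GrimmettPercolation1999].
-/

noncomputable section

namespace Literature.Probability.Percolation

namespace LSS

open _root_.MeasureTheory _root_.ProbabilityTheory MeasurableSpace
open scoped ENNReal


/-! ## Uniform variables -/

/-- Lebesgue measure on `[0,1]`, as a measure on `ℝ`. [folklore] -/
def unif : Measure ℝ := (volume : Measure ℝ).restrict (Set.Icc 0 1)

/-- `unif` is a probability measure. [folklore] -/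
instance : IsProbabilityMeasure unif :=
  ⟨by simp [unif, Real.volume_Icc]⟩

/-- `unif (-∞, a) = a` for `a ≤ 1` (and `a ≥ 0`; for `a < 0` both sides vanish). [folklore] -/
theorem unif_Iio {a : ℝ} (h1 : a ≤ 1) : unif (Set.Iio a) = ENNReal.ofReal a := by
  rw [unif, Measure.restrict_apply measurableSet_Iio]
  have : Set.Iio a ∩ Set.Icc 0 1 = Set.Ico 0 a := by
    ext x
    simp only [Set.mem_inter_iff, Set.mem_Iio, Set.mem_Icc, Set.mem_Ico]
    constructor
    · rintro ⟨h, h', -⟩; exact ⟨h', h⟩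
    · rintro ⟨h, h'⟩; exact ⟨h', h, by linarith⟩
  rw [this, Real.volume_Ico, sub_zero]

/-- Countably many independent uniforms. [folklore] -/
def μU : Measure (ℕ → ℝ) := Measure.infinitePi (fun _ : ℕ => unif)

/-- `μU` is a probability measure. [folklore] -/
instance : IsProbabilityMeasure μU := by unfold μU; infer_instance

/-- Measure of a finite-dimensional box under `μU`. [folklore] -/
theorem μU_pi (G : Finset ℕ) (t : ℕ → Set ℝ) (ht : ∀ i, MeasurableSet (t i)) :
    μU (Set.pi ↑G t) = ∏ i ∈ G, unif (t i) := by
  unfold μU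
  rw [Measure.infinitePi_pi _ (fun i _ => ht i)]

/-- `μU {u | u_i < θ_i ∀ i ∈ G} = ∏_{i ∈ G} θ_i` for thresholds in `[0,1]`. [folklore] -/
theorem μU_setOf_lt (G : Finset ℕ) (θ : ℕ → ℝ) (h0 : ∀ i ∈ G, 0 ≤ θ i) (h1 : ∀ i ∈ G, θ i ≤ 1) :
    μU {u | ∀ i ∈ G, u i < θ i} = ENNReal.ofReal (∏ i ∈ G, θ i) := by
  have : {u : ℕ → ℝ | ∀ i ∈ G, u i < θ i} = Set.pi ↑G (fun i => Set.Iio (θ i)) := by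
    ext u; simp [Set.mem_pi]
  rw [this, μU_pi G _ (fun i => measurableSet_Iio), ENNReal.ofReal_prod_of_nonneg h0]
  refine Finset.prod_congr rfl (fun i hi => ?_)
  by_cases hle : θ i ≤ 1
  · exact unif_Iio hle
  · exact absurd (h1 i hi) hle

/-! ## Independence on `Ω × (ℕ → ℝ)` -/

variable {Ω : Type*}

/-- The σ-algebra on `Ω × (ℕ → ℝ)` generated by `m` on the first factor and the coordinates
in `G` of the second. [folklore] -/
abbrev prodσ (m : MeasurableSpace Ω) (G : Finset ℕ) : MeasurableSpace (Ω × (ℕ → ℝ)) :=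
  m.comap Prod.fst ⊔ ⨆ i ∈ G, MeasurableSpace.comap (fun p : Ω × (ℕ → ℝ) => p.2 i) inferInstance

/-- Generating π-system of `prodσ m G`: rectangles `B ×ˢ pi G t`. [folklore] -/
def piSys (m : MeasurableSpace Ω) (G : Finset ℕ) : Set (Set (Ω × (ℕ → ℝ))) :=
  {S | ∃ B : Set Ω, MeasurableSet[m] B ∧ ∃ t : ℕ → Set ℝ, (∀ i, MeasurableSet (t i)) ∧
    S = B ×ˢ Set.pi ↑G t}

/-- The rectangles form a π-system. [folklore] -/
theorem isPiSystem_piSys (m : MeasurableSpace Ω) (G : Finset ℕ) : IsPiSystem (piSys m G) := by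
  rintro S ⟨B, hB, t, ht, rfl⟩ T ⟨B', hB', t', ht', rfl⟩ -
  refine ⟨B ∩ B', hB.inter hB', fun i => t i ∩ t' i, fun i => (ht i).inter (ht' i), ?_⟩
  rw [Set.prod_inter_prod, Set.pi_inter_distrib]

/-- Cylinders over the first factor are `prodσ`-measurable. [folklore] -/
theorem measurableSet_prodσ_fst {m : MeasurableSpace Ω} (G : Finset ℕ) {B : Set Ω}
    (hB : MeasurableSet[m] B) : MeasurableSet[prodσ m G] (Prod.fst ⁻¹' B : Set (Ω × (ℕ → ℝ))) := by
  refine (le_sup_left : m.comap Prod.fst ≤ prodσ m G) _ ?_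
  exact MeasurableSpace.measurableSet_comap.2 ⟨B, hB, rfl⟩

/-- Coordinate events `{p.2 i ∈ T}`, `i ∈ G`, are `prodσ m G`-measurable. [folklore] -/
theorem measurableSet_prodσ_snd (m : MeasurableSpace Ω) {G : Finset ℕ} {i : ℕ} (hi : i ∈ G)
    {T : Set ℝ} (hT : MeasurableSet T) :
    MeasurableSet[prodσ m G] ((fun p : Ω × (ℕ → ℝ) => p.2 i) ⁻¹' T) := by
  refine (le_sup_right : _ ≤ prodσ m G) _ ?_
  refine (le_iSup₂ (f := fun (i : ℕ) (_ : i ∈ G) =>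
    MeasurableSpace.comap (fun p : Ω × (ℕ → ℝ) => p.2 i) inferInstance) i hi) _ ?_
  exact MeasurableSpace.measurableSet_comap.2 ⟨T, hT, rfl⟩

/-- Boxes over the coordinates in `G` are `prodσ m G`-measurable. [folklore] -/
theorem measurableSet_prodσ_pi (m : MeasurableSpace Ω) (G : Finset ℕ) (t : ℕ → Set ℝ)
    (ht : ∀ i, MeasurableSet (t i)) :
    MeasurableSet[prodσ m G] (Prod.snd ⁻¹' Set.pi ↑G t : Set (Ω × (ℕ → ℝ))) := by
  have : (Prod.snd ⁻¹' Set.pi ↑G t : Set (Ω × (ℕ → ℝ))) =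
      ⋂ i ∈ G, (fun p : Ω × (ℕ → ℝ) => p.2 i) ⁻¹' t i := by
    ext p; simp [Set.mem_pi]
  rw [this]
  exact MeasurableSet.biInter G.countable_toSet (fun i hi => measurableSet_prodσ_snd m hi (ht i))

/-- `prodσ m G` is a sub-σ-algebra of the product σ-algebra when `m ≤ mΩ`. [folklore] -/
theorem prodσ_le {m : MeasurableSpace Ω} [mΩ : MeasurableSpace Ω] (hm : m ≤ mΩ) (G : Finset ℕ) :
    prodσ m G ≤ mΩ.prod inferInstance := by
  refine sup_le ?_ ?_
  · exact (MeasurableSpace.comap_mono hm).trans measurable_fst.comap_le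
  · refine iSup₂_le (fun i _ => ?_)
    exact ((measurable_pi_apply i).comp measurable_snd).comap_le

/-- `prodσ m G` is generated by the rectangles `piSys m G`. [folklore] -/
theorem generateFrom_piSys {m : MeasurableSpace Ω} (G : Finset ℕ) :
    MeasurableSpace.generateFrom (piSys m G) = prodσ m G := by
  apply le_antisymm
  · refine MeasurableSpace.generateFrom_le ?_
    rintro S ⟨B, hB, t, ht, rfl⟩
    rw [Set.prod_eq]
    exact (measurableSet_prodσ_fst G hB).inter (measurableSet_prodσ_pi m G t ht)
  · refine sup_le ?_ ?_
    · intro s hs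
      obtain ⟨B, hB, rfl⟩ := MeasurableSpace.measurableSet_comap.1 hs
      refine MeasurableSpace.measurableSet_generateFrom ⟨B, hB, fun _ => Set.univ,
        fun _ => MeasurableSet.univ, ?_⟩
      rw [Set.pi_univ, Set.prod_univ]
    · refine iSup₂_le (fun i hi => ?_)
      intro s hs
      obtain ⟨T, hT, rfl⟩ := MeasurableSpace.measurableSet_comap.1 hs
      refine MeasurableSpace.measurableSet_generateFrom ⟨Set.univ, MeasurableSet.univ,
        fun j => if j = i then T else Set.univ, fun j => ?_, ?_⟩
      · by_cases h : j = i
        · simp only [h, if_true]; exact hT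
        · simp only [h, if_false]; exact MeasurableSet.univ
      · ext p
        simp only [Set.mem_preimage, Set.mem_prod, Set.mem_univ, true_and, Set.mem_pi,
          Finset.mem_coe]
        constructor
        · intro hp j hj
          by_cases h : j = i
          · subst h; simpa using hp
          · simp [h]
        · intro hp
          simpa using hp i hi

/-- Measure of a rectangle of the π-system. [folklore] -/
theorem prod_μU_rect [MeasurableSpace Ω] (P : Measure Ω) [SFinite P] (B : Set Ω)
    (G : Finset ℕ) (t : ℕ → Set ℝ) (ht : ∀ i, MeasurableSet (t i)) :
    (P.prod μU) (B ×ˢ Set.pi ↑G t) = P B * ∏ i ∈ G, unif (t i) := by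
  rw [Measure.prod_prod, μU_pi G t ht]

/-- **Independence on the product space.** If `m₁, m₂` are independent under `P`, then on
`Ω × [0,1]^ℕ` (product with i.i.d. uniforms) the σ-algebra generated by `m₁` and the
coordinates in `G₁` is independent of that generated by `m₂` and the coordinates in `G₂`,
for disjoint `G₁, G₂`. [folklore] -/
theorem indep_prodσ {m₁ m₂ : MeasurableSpace Ω} [mΩ : MeasurableSpace Ω] {P : Measure Ω}
    [IsProbabilityMeasure P] (h₁ : m₁ ≤ mΩ) (h₂ : m₂ ≤ mΩ) (hind : Indep m₁ m₂ P)
    {G₁ G₂ : Finset ℕ} (hG : Disjoint G₁ G₂) :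
    Indep (prodσ m₁ G₁) (prodσ m₂ G₂) (P.prod μU) := by
  classical
  refine IndepSets.indep (prodσ_le h₁ G₁) (prodσ_le h₂ G₂) (isPiSystem_piSys m₁ G₁)
    (isPiSystem_piSys m₂ G₂) (generateFrom_piSys G₁).symm (generateFrom_piSys G₂).symm ?_
  rw [IndepSets_iff]
  rintro S T ⟨B, hB, t, ht, rfl⟩ ⟨B', hB', t', ht', rfl⟩
  -- the combined box
  set t'' : ℕ → Set ℝ := fun i => if i ∈ G₁ then t i else t' i with ht''def
  have ht'' : ∀ i, MeasurableSet (t'' i) := fun i => by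
    by_cases h : i ∈ G₁ <;> simp [ht''def, h, ht i, ht' i]
  have hpi : Set.pi ↑G₁ t ∩ Set.pi ↑G₂ t' = Set.pi ↑(G₁ ∪ G₂) t'' := by
    ext u
    simp only [Set.mem_inter_iff, Set.mem_pi, Finset.mem_coe, Finset.mem_union, ht''def]
    constructor
    · rintro ⟨hu1, hu2⟩ i hi
      by_cases h : i ∈ G₁
      · simp only [h, if_true]; exact hu1 i h
      · simp only [h, if_false]
        rcases hi with hi | hi
        · exact absurd hi h
        · exact hu2 i hi
    · intro hu
      refine ⟨fun i hi => ?_, fun i hi => ?_⟩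
      · simpa [hi] using hu i (Or.inl hi)
      · have h : i ∉ G₁ := fun h' => Finset.disjoint_left.1 hG h' hi
        simpa [h] using hu i (Or.inr hi)
  have hinter : B ×ˢ Set.pi ↑G₁ t ∩ B' ×ˢ Set.pi ↑G₂ t' = (B ∩ B') ×ˢ Set.pi ↑(G₁ ∪ G₂) t'' := by
    rw [Set.prod_inter_prod, hpi]
  rw [hinter, prod_μU_rect P _ _ _ ht'', prod_μU_rect P _ _ _ ht, prod_μU_rect P _ _ _ ht',
    Finset.prod_union hG]
  have hBB' : P (B ∩ B') = P B * P B' := (Indep_iff m₁ m₂ P).1 hind B B' hB hB'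
  have hp1 : ∏ i ∈ G₁, unif (t'' i) = ∏ i ∈ G₁, unif (t i) :=
    Finset.prod_congr rfl (fun i hi => by simp [ht''def, hi])
  have hp2 : ∏ i ∈ G₂, unif (t'' i) = ∏ i ∈ G₂, unif (t' i) :=
    Finset.prod_congr rfl (fun i hi => by
      have h : i ∉ G₁ := fun h' => Finset.disjoint_left.1 hG h' hi
      simp [ht''def, h])
  rw [hBB', hp1, hp2]
  ring



variable {Ω : Type*}

/-! ## Atoms of finitely many events -/

/-- The atom `⋂_{i ∈ F} Z_i^{ε_i}` (`Z_i` if `ε_i`, its complement otherwise). [folklore] -/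
def atom (Z : ℕ → Set Ω) (F : Finset ℕ) (ε : ℕ → Bool) : Set Ω :=
  ⋂ i ∈ F, if ε i then Z i else (Z i)ᶜ

/-- The empty atom is everything. [folklore] -/
theorem atom_empty (Z : ℕ → Set Ω) (ε : ℕ → Bool) : atom Z ∅ ε = Set.univ := by
  simp [atom]

/-- Peeling one event off an atom. [folklore] -/
theorem atom_insert (Z : ℕ → Set Ω) (F : Finset ℕ) (m : ℕ) (ε : ℕ → Bool) :
    atom Z (insert m F) ε = (if ε m then Z m else (Z m)ᶜ) ∩ atom Z F ε := by
  simp only [atom, Finset.set_biInter_insert]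

/-- Atoms over a union of index sets. [folklore] -/
theorem atom_union (Z : ℕ → Set Ω) (F₁ F₂ : Finset ℕ) (ε : ℕ → Bool) :
    atom Z (F₁ ∪ F₂) ε = atom Z F₁ ε ∩ atom Z F₂ ε := by
  simp only [atom, Finset.set_biInter_inter]

/-- Atoms are antitone in the index set. [folklore] -/
theorem atom_mono (Z : ℕ → Set Ω) {F₁ F₂ : Finset ℕ} (h : F₁ ⊆ F₂) (ε : ℕ → Bool) :
    atom Z F₂ ε ⊆ atom Z F₁ ε := by
  intro ω hω
  simp only [atom, Set.mem_iInter] at hω ⊢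
  exact fun i hi => hω i (h hi)

/-- Membership in an atom. [folklore] -/
theorem mem_atom (Z : ℕ → Set Ω) (F : Finset ℕ) (ε : ℕ → Bool) (ω : Ω) :
    ω ∈ atom Z F ε ↔ ∀ i ∈ F, (ω ∈ Z i ↔ ε i = true) := by
  simp only [atom, Set.mem_iInter]
  refine forall₂_congr (fun i _ => ?_)
  cases ε i <;> simp

/-- Atoms of measurable events are measurable. [folklore] -/
theorem measurableSet_atom [MeasurableSpace Ω] {Z : ℕ → Set Ω} (hZ : ∀ i, MeasurableSet (Z i))
    (F : Finset ℕ) (ε : ℕ → Bool) : MeasurableSet (atom Z F ε) := by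
  refine MeasurableSet.biInter F.countable_toSet (fun i _ => ?_)
  split_ifs
  · exact hZ i
  · exact (hZ i).compl

/-! ## Proposition 1.2 of Liggett–Schonmann–Stacey -/

section Prop12

variable [MeasurableSpace Ω] (P : Measure Ω) [IsFiniteMeasure P]

/-- `P(X ∩ A) = P(A) - P(Xᶜ ∩ A)`. [folklore] -/
theorem measureReal_inter_eq_sub {X A : Set Ω} (hX : MeasurableSet X) :
    P.real (X ∩ A) = P.real A - P.real (Xᶜ ∩ A) := by
  have h := measureReal_inter_add_sdiff (μ := P) (s := A) hX
  rw [Set.sdiff_eq] at h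
  rw [Set.inter_comm X A, Set.inter_comm Xᶜ A]
  linarith

/-- The step "`P(Z_m = 1 | A) = r P(X_m = 1 | A) ≥ r α P(A)`". [cite: LiggettSchonmannStacey1997, Prop 1.2, (1.4)⇔(1.5)] -/
theorem real_Z_inter_ge {X Yev A : Set Ω} (hX : MeasurableSet X) {α r : ℝ} (hr : 0 ≤ r)
    (h2 : P.real (Yev ∩ (X ∩ A)) = r * P.real (X ∩ A))
    (hIH : P.real (Xᶜ ∩ A) ≤ (1 - α) * P.real A) :
    α * r * P.real A ≤ P.real (X ∩ Yev ∩ A) := by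
  have hset : X ∩ Yev ∩ A = Yev ∩ (X ∩ A) := by
    ext ω; simp only [Set.mem_inter_iff]; tauto
  rw [hset, h2, measureReal_inter_eq_sub P hX]
  nlinarith [measureReal_nonneg (μ := P) (s := A)]

/-- **LSS Proposition 1.2** (atom form, abstract hypotheses). `X n` are the events `{X_n = 1}`,
`Yev n` the auxiliary independent Bernoulli(`r`) events, `Z n = X n ∩ Yev n`; `bad n` contains the
neighbours of `n` in the dependence graph (at most `Δ` of them). Hypotheses: (h1) outside its
neighbourhood `X_n` fails with conditional probability `≤ q`; (h2)/(h3) `Yev m` is independent,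
with probability `r`, of everything else. Conclusion (1.4): `P(X_n = 0 | Z-atom) ≤ 1 - α`
whenever `q ≤ (1-α) min(αr, 1-r)^Δ` (a cruder form of (1.2)–(1.3), sufficient for Thm 0.0).
[cite: LiggettSchonmannStacey1997, Prop 1.2] -/
theorem prop12 {X Yev Z : ℕ → Set Ω} (hX : ∀ n, MeasurableSet (X n))
    (hYev : ∀ n, MeasurableSet (Yev n)) (hZ : ∀ n, Z n = X n ∩ Yev n)
    (bad : ℕ → Finset ℕ) {Δ : ℕ} (hcard : ∀ n, (bad n).card ≤ Δ) {q α r : ℝ}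
    (hα1 : α ≤ 1) (hr0 : 0 ≤ r)
    (hq : q ≤ (1 - α) * (min (α * r) (1 - r)) ^ Δ)
    (h1 : ∀ n F, Disjoint (bad n) F → n ∉ F → ∀ ε,
      P.real ((X n)ᶜ ∩ atom Z F ε) ≤ q * P.real (atom Z F ε))
    (h2 : ∀ m F, m ∉ F → ∀ ε,
      P.real (Yev m ∩ (X m ∩ atom Z F ε)) = r * P.real (X m ∩ atom Z F ε))
    (h3 : ∀ m F, m ∉ F → ∀ ε, P.real (Yev m ∩ atom Z F ε) = r * P.real (atom Z F ε))
    (hc0 : 0 ≤ min (α * r) (1 - r))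
    (F : Finset ℕ) : ∀ n, n ∉ F → ∀ ε : ℕ → Bool,
    P.real ((X n)ᶜ ∩ atom Z F ε) ≤ (1 - α) * P.real (atom Z F ε) := by
  classical
  set c := min (α * r) (1 - r) with hc
  have hc1 : c ≤ 1 := (min_le_right _ _).trans (by linarith)
  induction F using Finset.strongInduction with
  | H F IH =>
  intro n hn ε
  set F₀ := F.filter (· ∈ bad n) with hF₀
  set F₁ := F.filter (· ∉ bad n) with hF₁
  have hF : F₀ ∪ F₁ = F := Finset.filter_union_filter_not_eq _ _
  have hF₁F : F₁ ⊆ F := Finset.filter_subset _ _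
  have hF₀F : F₀ ⊆ F := Finset.filter_subset _ _
  have hdisj : Disjoint (bad n) F₁ := by
    rw [Finset.disjoint_left]
    intro i hi hi1
    exact (Finset.mem_filter.1 hi1).2 hi
  have hn1 : n ∉ F₁ := fun h => hn (hF₁F h)
  -- Step 1: drop the neighbours from the atom and use (h1)
  have step1 : P.real ((X n)ᶜ ∩ atom Z F ε) ≤ q * P.real (atom Z F₁ ε) :=
    (measureReal_mono (Set.inter_subset_inter_right _ (atom_mono Z hF₁F ε))).trans
      (h1 n F₁ hdisj hn1 ε)
  -- Step 2: put the neighbours back one at a time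
  have step2 : ∀ F₀' : Finset ℕ, F₀' ⊆ F₀ →
      c ^ F₀'.card * P.real (atom Z F₁ ε) ≤ P.real (atom Z (F₀' ∪ F₁) ε) := by
    intro F₀'
    induction F₀' using Finset.induction_on with
    | empty => intro _; simp
    | insert m F₀' hm ih =>
      intro hsub
      have hmF₀ : m ∈ F₀ := hsub (Finset.mem_insert_self _ _)
      have hsub' : F₀' ⊆ F₀ := fun i hi => hsub (Finset.mem_insert_of_mem hi)
      have hmF : m ∈ F := hF₀F hmF₀
      have hmF₁ : m ∉ F₁ := fun h => (Finset.mem_filter.1 h).2 (Finset.mem_filter.1 hmF₀).2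
      set F' := F₀' ∪ F₁ with hF'
      have hmF' : m ∉ F' := by
        rw [hF', Finset.mem_union, not_or]; exact ⟨hm, hmF₁⟩
      have hF'F : F' ⊂ F := by
        refine Finset.ssubset_iff_subset_ne.2 ⟨Finset.union_subset (hsub'.trans hF₀F) hF₁F, ?_⟩
        intro hEq
        rw [hEq] at hmF'
        exact hmF' hmF
      have hIH : P.real ((X m)ᶜ ∩ atom Z F' ε) ≤ (1 - α) * P.real (atom Z F' ε) :=
        IH F' hF'F m hmF' ε
      have hA0 : 0 ≤ P.real (atom Z F' ε) := measureReal_nonneg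
      -- the one-step bound `c P(A') ≤ P(Z_m^{ε_m} ∩ A')`
      have hstep : c * P.real (atom Z F' ε) ≤ P.real (atom Z (insert m F') ε) := by
        rw [atom_insert]
        cases hεm : ε m
        · -- `ε m = false`: `P(Z_mᶜ ∩ A') ≥ P(Yev_mᶜ ∩ A') = (1 - r) P(A')`
          simp only [Bool.false_eq_true, if_false]
          have hsub1 : (Yev m)ᶜ ∩ atom Z F' ε ⊆ (Z m)ᶜ ∩ atom Z F' ε := by
            rw [hZ m]
            exact Set.inter_subset_inter_left _ (Set.compl_subset_compl.2 Set.inter_subset_right)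
          have heq : P.real ((Yev m)ᶜ ∩ atom Z F' ε) = (1 - r) * P.real (atom Z F' ε) := by
            rw [measureReal_inter_eq_sub P (hYev m).compl, compl_compl, h3 m F' hmF' ε]; ring
          calc c * P.real (atom Z F' ε) ≤ (1 - r) * P.real (atom Z F' ε) :=
                mul_le_mul_of_nonneg_right (min_le_right _ _) hA0
            _ = P.real ((Yev m)ᶜ ∩ atom Z F' ε) := heq.symm
            _ ≤ P.real ((Z m)ᶜ ∩ atom Z F' ε) := measureReal_mono hsub1
        · -- `ε m = true`: `P(Z_m ∩ A') = r P(X_m ∩ A') ≥ r α P(A')`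
          simp only [if_true]
          rw [hZ m]
          calc c * P.real (atom Z F' ε) ≤ α * r * P.real (atom Z F' ε) :=
                mul_le_mul_of_nonneg_right (min_le_left _ _) hA0
            _ ≤ P.real (X m ∩ Yev m ∩ atom Z F' ε) :=
                real_Z_inter_ge P (hX m) hr0 (h2 m F' hmF' ε) hIH
      have hins : insert m F₀' ∪ F₁ = insert m F' := by
        rw [hF', Finset.insert_union]
      rw [hins, Finset.card_insert_of_notMem hm, pow_succ]
      calc c ^ F₀'.card * c * P.real (atom Z F₁ ε)
          = c * (c ^ F₀'.card * P.real (atom Z F₁ ε)) := by ring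
        _ ≤ c * P.real (atom Z F' ε) := mul_le_mul_of_nonneg_left (ih hsub') (hc ▸ hc0)
        _ ≤ P.real (atom Z (insert m F') ε) := hstep
  have step2' : c ^ F₀.card * P.real (atom Z F₁ ε) ≤ P.real (atom Z F ε) := by
    have := step2 F₀ le_rfl
    rwa [hF] at this
  have hcardF₀ : F₀.card ≤ Δ :=
    (Finset.card_le_card (fun i hi => (Finset.mem_filter.1 hi).2)).trans (hcard n)
  have hA1 : 0 ≤ P.real (atom Z F₁ ε) := measureReal_nonneg
  have h1α : 0 ≤ 1 - α := by linarith
  calc P.real ((X n)ᶜ ∩ atom Z F ε) ≤ q * P.real (atom Z F₁ ε) := step1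
    _ ≤ (1 - α) * c ^ Δ * P.real (atom Z F₁ ε) := mul_le_mul_of_nonneg_right hq hA1
    _ ≤ (1 - α) * c ^ F₀.card * P.real (atom Z F₁ ε) := by
        refine mul_le_mul_of_nonneg_right (mul_le_mul_of_nonneg_left ?_ h1α) hA1
        exact pow_le_pow_of_le_one (hc ▸ hc0) hc1 hcardF₀
    _ = (1 - α) * (c ^ F₀.card * P.real (atom Z F₁ ε)) := by ring
    _ ≤ (1 - α) * P.real (atom Z F ε) := mul_le_mul_of_nonneg_left step2' h1α

end Prop12



/-! ## The σ-algebra on `Set α` is generated by the π-system `{s | G ⊆ s}`, `G` finite -/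

/-- The events "all sites of `G` are occupied". [folklore] -/
def supsets (α : Type*) : Set (Set (Set α)) := Set.range fun G : Finset α => {s : Set α | ↑G ⊆ s}

/-- `{s | G₁ ⊆ s} ∩ {s | G₂ ⊆ s} = {s | G₁ ∪ G₂ ⊆ s}`: the events `supsets α` form a π-system. [folklore] -/
theorem isPiSystem_supsets (α : Type*) [DecidableEq α] : IsPiSystem (supsets α) := by
  rintro _ ⟨G₁, rfl⟩ _ ⟨G₂, rfl⟩ -
  refine ⟨G₁ ∪ G₂, ?_⟩
  ext s
  simp [Set.union_subset_iff]

/-- `{s | G ⊆ s} = ⋂_{a ∈ G} {s | a ∈ s}`. [folklore] -/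
theorem setOf_subset_eq_iInter {α : Type*} (G : Finset α) :
    {s : Set α | ↑G ⊆ s} = ⋂ a ∈ G, {s : Set α | a ∈ s} := by
  ext s; simp [Set.subset_def]

/-- The events `{s | G ⊆ s}` are measurable for the product σ-algebra on `Set α`. [folklore] -/
theorem measurableSet_supsets {α : Type*} {S : Set (Set α)} (hS : S ∈ supsets α) :
    MeasurableSet S := by
  obtain ⟨G, rfl⟩ := hS
  change MeasurableSet {s : Set α | (↑G : Set α) ⊆ s}
  rw [setOf_subset_eq_iInter]
  exact MeasurableSet.biInter G.countable_toSet (fun a _ => measurableSet_mem a)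

/-- The product σ-algebra on `Set α` (Mathlib's `Set.instMeasurableSpace`, generated by the
memberships `a ∈ s`) is generated by the π-system `supsets α`. [folklore] -/
theorem generateFrom_supsets (α : Type*) :
    (Set.instMeasurableSpace : MeasurableSpace (Set α)) = generateFrom (supsets α) := by
  apply le_antisymm
  · have h : ∀ a : α, Measurable[generateFrom (supsets α)] (fun s : Set α => a ∈ s) := by
      intro a
      refine measurable_to_prop ?_
      refine measurableSet_generateFrom ⟨{a}, ?_⟩
      ext s
      simp
    exact iSup_le (fun a => measurable_iff_comap_le.1 (h a))
  · exact generateFrom_le (fun S hS => measurableSet_supsets hS)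

/-- Two probability measures on `Set α` (laws of random subsets of `α`) agreeing on the events
`{s | G ⊆ s}`, `G` finite, are equal (π-λ). [folklore] -/
theorem measure_set_ext {α : Type*} [DecidableEq α] {μ ν : Measure (Set α)} [IsProbabilityMeasure μ]
    [IsProbabilityMeasure ν] (h : ∀ G : Finset α, μ {s | ↑G ⊆ s} = ν {s | ↑G ⊆ s}) : μ = ν := by
  refine ext_of_generate_finite (supsets α) (generateFrom_supsets α) (isPiSystem_supsets α) ?_
    (by simp)
  rintro _ ⟨G, rfl⟩
  exact h G

/-! ## Lemma 1.1 of Liggett–Schonmann–Stacey: the sequential coupling -/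

section SeqCoupling

variable {Ω₁ : Type*}

/-- History of the first `n` events at `ω`. [folklore] -/
def histF (Z : ℕ → Set Ω₁) (n : ℕ) (ω : Ω₁) : Fin n → Bool := fun i => (Z i.1).boolIndicator ω

/-- The history atom `{ω | (1_{Z_i}(ω))_{i<n} = e}`. [folklore] -/
def atomF (Z : ℕ → Set Ω₁) (n : ℕ) (e : Fin n → Bool) : Set Ω₁ := histF Z n ⁻¹' {e}

/-- Membership in an atom. [folklore] -/
theorem mem_atomF {Z : ℕ → Set Ω₁} {n : ℕ} {e : Fin n → Bool} {ω : Ω₁} :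
    ω ∈ atomF Z n e ↔ ∀ i : Fin n, (ω ∈ Z i.1 ↔ e i = true) := by
  simp only [atomF, Set.mem_preimage, Set.mem_singleton_iff, funext_iff, histF]
  refine forall_congr' (fun i => ?_)
  cases e i
  · simpa using (Set.notMem_iff_boolIndicator (s := Z i.1) ω).symm
  · simpa using (Set.mem_iff_boolIndicator (s := Z i.1) ω).symm

/-- Extension of a finite history by `false`. [folklore] -/
def extF {m : ℕ} (e : Fin m → Bool) (i : ℕ) : Bool := if h : i < m then e ⟨i, h⟩ else false

/-- Restricting the extension of `e` back to `Fin m` gives `e`. [folklore] -/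
theorem extF_self {m : ℕ} (e : Fin m → Bool) : (fun i : Fin m => extF e i.1) = e := by
  funext i; simp [extF, i.2]

/-- On the history atom of `e` at time `m`, the history at an earlier time `n ≤ m` is the
restriction of `e`. [folklore] -/
theorem histF_eq_of_mem_atomF {Z : ℕ → Set Ω₁} {m n : ℕ} {e : Fin m → Bool} {ω : Ω₁}
    (hω : ω ∈ atomF Z m e) (hn : n ≤ m) : histF Z n ω = fun i : Fin n => extF e i.1 := by
  rw [mem_atomF] at hω
  funext i
  have hi : (i.1 : ℕ) < m := lt_of_lt_of_le i.2 hn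
  have := hω ⟨i.1, hi⟩
  simp only [histF, extF, hi, dif_pos]
  cases h : e ⟨i.1, hi⟩
  · rw [h] at this
    exact (Set.notMem_iff_boolIndicator (s := Z i.1) ω).1 (by simpa using this)
  · rw [h] at this
    exact (Set.mem_iff_boolIndicator (s := Z i.1) ω).1 (by simpa using this)

/-- On the history atom of `e` at time `m`, `Z_n` (`n < m`) happens iff `e_n = 1`. [folklore] -/
theorem mem_Z_iff_of_mem_atomF {Z : ℕ → Set Ω₁} {m n : ℕ} {e : Fin m → Bool} {ω : Ω₁}
    (hω : ω ∈ atomF Z m e) (hn : n < m) : ω ∈ Z n ↔ extF e n = true := by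
  rw [mem_atomF] at hω
  simpa [extF, hn] using hω ⟨n, hn⟩

variable [MeasurableSpace Ω₁]

/-- Histories of measurable events are measurable. [folklore] -/
theorem measurable_histF {Z : ℕ → Set Ω₁} (hZ : ∀ i, MeasurableSet (Z i)) (n : ℕ) :
    Measurable (histF Z n) := by
  refine measurable_pi_iff.2 (fun i => ?_)
  refine measurable_to_bool ?_
  show MeasurableSet ((Z i.1).boolIndicator ⁻¹' {true})
  rw [Set.preimage_boolIndicator_true]; exact hZ _

/-- Atoms of measurable events are measurable. [folklore] -/
theorem measurableSet_atomF {Z : ℕ → Set Ω₁} (hZ : ∀ i, MeasurableSet (Z i)) (n : ℕ)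
    (e : Fin n → Bool) : MeasurableSet (atomF Z n e) :=
  measurable_histF hZ n (measurableSet_singleton e)

variable (P₁ : Measure Ω₁) (Z : ℕ → Set Ω₁) (ρ : ℕ → ℝ)

/-- The acceptance threshold `θ_n(e) = ρ_n P(A_e) / P(Z_n ∩ A_e)` of the sequential coupling.
[cite: LiggettSchonmannStacey1997, Lemma 1.1 (proof omitted there; Russo 1982, Lemma 1)] -/
def θ (n : ℕ) (e : Fin n → Bool) : ℝ :=
  if P₁.real (Z n ∩ atomF Z n e) = 0 then 0
  else ρ n * P₁.real (atomF Z n e) / P₁.real (Z n ∩ atomF Z n e)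

/-- The coupled events `V_n = {Z_n ∧ U_n < θ_n(history)}` on `Ω₁ × [0,1]^ℕ`. [folklore] -/
def V (n : ℕ) : Set (Ω₁ × (ℕ → ℝ)) := {p | p.1 ∈ Z n ∧ p.2 n < θ P₁ Z ρ n (histF Z n p.1)}

variable {P₁ Z ρ}

/-- The thresholds are nonnegative. [folklore] -/
theorem θ_nonneg (hρ : ∀ n, 0 ≤ ρ n) (n : ℕ) (e : Fin n → Bool) : 0 ≤ θ P₁ Z ρ n e := by
  unfold θ
  split_ifs
  · exact le_rfl
  · exact div_nonneg (mul_nonneg (hρ n) measureReal_nonneg) measureReal_nonneg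

/-- The thresholds are at most `1`, by the domination hypothesis `ρ_n P(A) ≤ P(Z_n ∩ A)`.
[cite: LiggettSchonmannStacey1997, Lemma 1.1] -/
theorem θ_le_one
    (hdom : ∀ n e, ρ n * P₁.real (atomF Z n e) ≤ P₁.real (Z n ∩ atomF Z n e))
    (n : ℕ) (e : Fin n → Bool) : θ P₁ Z ρ n e ≤ 1 := by
  unfold θ
  split_ifs with h
  · exact zero_le_one
  · rw [div_le_one (lt_of_le_of_ne measureReal_nonneg (Ne.symm h))]
    exact hdom n e

/-- The defining identity of the thresholds: `P(Z_n ∩ A_e) θ_n(e) = ρ_n P(A_e)` (also in the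
degenerate case `P(Z_n ∩ A_e) = 0`, where both sides vanish). [cite: LiggettSchonmannStacey1997, Lemma 1.1] -/
theorem real_mul_θ (hρ : ∀ n, 0 ≤ ρ n)
    (hdom : ∀ n e, ρ n * P₁.real (atomF Z n e) ≤ P₁.real (Z n ∩ atomF Z n e))
    (n : ℕ) (e : Fin n → Bool) :
    P₁.real (Z n ∩ atomF Z n e) * θ P₁ Z ρ n e = ρ n * P₁.real (atomF Z n e) := by
  unfold θ
  split_ifs with h
  · rw [h, zero_mul]
    have h1 := hdom n e
    rw [h] at h1
    have h2 : 0 ≤ ρ n * P₁.real (atomF Z n e) := mul_nonneg (hρ n) measureReal_nonneg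
    linarith
  · field_simp

/-- `V_n` as a finite union of measurable rectangles. [folklore] -/
theorem V_eq_iUnion (n : ℕ) :
    V P₁ Z ρ n = ⋃ e : Fin n → Bool, (Z n ∩ atomF Z n e) ×ˢ {u | u n < θ P₁ Z ρ n e} := by
  ext ⟨ω, u⟩
  simp only [V, Set.mem_setOf_eq, Set.mem_iUnion, Set.mem_prod, Set.mem_inter_iff, atomF,
    Set.mem_preimage, Set.mem_singleton_iff]
  constructor
  · rintro ⟨h1, h2⟩; exact ⟨_, ⟨h1, rfl⟩, h2⟩
  · rintro ⟨e, ⟨h1, rfl⟩, h2⟩; exact ⟨h1, h2⟩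

/-- The coupled events are measurable. [folklore] -/
theorem measurableSet_V (hZ : ∀ i, MeasurableSet (Z i)) (n : ℕ) : MeasurableSet (V P₁ Z ρ n) := by
  rw [V_eq_iUnion]
  refine MeasurableSet.iUnion (fun e => ?_)
  exact ((hZ n).inter (measurableSet_atomF hZ n e)).prod
    (measurableSet_lt (measurable_pi_apply n) measurable_const)

/-- The thresholds along a fixed history `e`. [folklore] -/
def Θ {m : ℕ} (e : Fin m → Bool) (n : ℕ) : ℝ := θ P₁ Z ρ n (fun i : Fin n => extF e i.1)

/-- `μU {u | u_n < Θ_n(e) ∀ n ∈ G} = ∏_{n ∈ G} Θ_n(e)`. [folklore] -/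
theorem μU_real_setOf_lt (hρ : ∀ n, 0 ≤ ρ n)
    (hdom : ∀ n e, ρ n * P₁.real (atomF Z n e) ≤ P₁.real (Z n ∩ atomF Z n e))
    {m : ℕ} (e : Fin m → Bool) (G : Finset ℕ) :
    μU.real {u | ∀ n ∈ G, u n < Θ (P₁ := P₁) (Z := Z) (ρ := ρ) e n} =
      ∏ n ∈ G, Θ (P₁ := P₁) (Z := Z) (ρ := ρ) e n := by
  rw [measureReal_def, μU_setOf_lt G (Θ (P₁ := P₁) (Z := Z) (ρ := ρ) e)
    (fun n _ => θ_nonneg hρ _ _) (fun n _ => θ_le_one hdom _ _), ENNReal.toReal_ofReal]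
  exact Finset.prod_nonneg (fun n _ => θ_nonneg hρ _ _)

/-- **One step of the sequential coupling, on a history atom.** [cite: LiggettSchonmannStacey1997, Lemma 1.1] -/
theorem real_iInter_V_inter_atom [SFinite P₁] (hρ : ∀ n, 0 ≤ ρ n)
    (hdom : ∀ n e, ρ n * P₁.real (atomF Z n e) ≤ P₁.real (Z n ∩ atomF Z n e))
    {m : ℕ} {G : Finset ℕ} (hG : ∀ n ∈ G, n < m) (e : Fin m → Bool) :
    (P₁.prod μU).real ((⋂ n ∈ insert m G, V P₁ Z ρ n) ∩ Prod.fst ⁻¹' atomF Z m e) =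
      ρ m * (P₁.prod μU).real ((⋂ n ∈ G, V P₁ Z ρ n) ∩ Prod.fst ⁻¹' atomF Z m e) := by
  have hmG : m ∉ G := fun h => lt_irrefl _ (hG m h)
  by_cases good : ∀ n ∈ G, extF e n = true
  · -- all of `G` is occupied along `e`: both sides are rectangles
    have hset1 : (⋂ n ∈ G, V P₁ Z ρ n) ∩ Prod.fst ⁻¹' atomF Z m e =
        atomF Z m e ×ˢ {u | ∀ n ∈ G, u n < Θ (P₁ := P₁) (Z := Z) (ρ := ρ) e n} := by
      ext ⟨ω, u⟩
      simp only [Set.mem_inter_iff, Set.mem_iInter, Set.mem_preimage, Set.mem_prod,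
        Set.mem_setOf_eq, V]
      constructor
      · rintro ⟨h, hω⟩
        refine ⟨hω, fun n hn => ?_⟩
        have := (h n hn).2
        rwa [histF_eq_of_mem_atomF hω (hG n hn).le] at this
      · rintro ⟨hω, h⟩
        refine ⟨fun n hn => ⟨(mem_Z_iff_of_mem_atomF hω (hG n hn)).2 (good n hn), ?_⟩, hω⟩
        rw [histF_eq_of_mem_atomF hω (hG n hn).le]
        exact h n hn
    have hset2 : (⋂ n ∈ insert m G, V P₁ Z ρ n) ∩ Prod.fst ⁻¹' atomF Z m e =
        (Z m ∩ atomF Z m e) ×ˢ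
          {u | ∀ n ∈ insert m G, u n < Θ (P₁ := P₁) (Z := Z) (ρ := ρ) e n} := by
      rw [Finset.set_biInter_insert, Set.inter_assoc, hset1]
      ext ⟨ω, u⟩
      simp only [Set.mem_inter_iff, Set.mem_prod, Set.mem_setOf_eq, V, Finset.forall_mem_insert]
      constructor
      · rintro ⟨⟨hZm, hu⟩, hω, h⟩
        refine ⟨⟨hZm, hω⟩, ?_, h⟩
        rwa [histF_eq_of_mem_atomF hω le_rfl] at hu
      · rintro ⟨⟨hZm, hω⟩, hu, h⟩
        refine ⟨⟨hZm, ?_⟩, hω, h⟩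
        rw [histF_eq_of_mem_atomF hω le_rfl]
        exact hu
    rw [hset1, hset2, measureReal_prod_prod, measureReal_prod_prod,
      μU_real_setOf_lt hρ hdom, μU_real_setOf_lt hρ hdom, Finset.prod_insert hmG]
    have hΘm : Θ (P₁ := P₁) (Z := Z) (ρ := ρ) e m = θ P₁ Z ρ m e := by
      simp only [Θ, extF_self]
    rw [hΘm]
    have key := real_mul_θ hρ hdom m e
    calc P₁.real (Z m ∩ atomF Z m e) * (θ P₁ Z ρ m e * ∏ n ∈ G, Θ e n)
        = (P₁.real (Z m ∩ atomF Z m e) * θ P₁ Z ρ m e) * ∏ n ∈ G, Θ e n := by ring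
      _ = ρ m * (P₁.real (atomF Z m e) * ∏ n ∈ G, Θ e n) := by rw [key]; ring
  · -- some site of `G` is vacant along `e`: both sides vanish
    push Not at good
    obtain ⟨n, hn, hfalse⟩ := good
    have hempty : (⋂ n ∈ G, V P₁ Z ρ n) ∩ Prod.fst ⁻¹' atomF Z m e = ∅ := by
      ext ⟨ω, u⟩
      simp only [Set.mem_inter_iff, Set.mem_iInter, Set.mem_preimage, Set.mem_empty_iff_false,
        iff_false, not_and]
      intro h hω
      have h1 : ω ∈ Z n := (h n hn).1
      rw [mem_Z_iff_of_mem_atomF hω (hG n hn)] at h1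
      exact hfalse h1
    have hempty2 : (⋂ n ∈ insert m G, V P₁ Z ρ n) ∩ Prod.fst ⁻¹' atomF Z m e = ∅ := by
      apply Set.eq_empty_of_subset_empty
      rw [← hempty, Finset.set_biInter_insert, Set.inter_assoc]
      exact Set.inter_subset_right
    rw [hempty, hempty2, measureReal_empty, mul_zero]

/-- Partition of `Ω₁ × [0,1]^ℕ` by the history atoms at time `m`. [folklore] -/
theorem real_eq_sum_atomF [IsFiniteMeasure P₁] (hZ : ∀ i, MeasurableSet (Z i)) (m : ℕ)
    {B : Set (Ω₁ × (ℕ → ℝ))} :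
    (P₁.prod μU).real B = ∑ e : Fin m → Bool, (P₁.prod μU).real (B ∩ Prod.fst ⁻¹' atomF Z m e) := by
  have hf : Measurable (histF Z m ∘ (Prod.fst : Ω₁ × (ℕ → ℝ) → Ω₁)) :=
    (measurable_histF hZ m).comp measurable_fst
  have hmeas : ∀ e : Fin m → Bool, MeasurableSet ((histF Z m ∘ Prod.fst) ⁻¹' {e} :
      Set (Ω₁ × (ℕ → ℝ))) := fun e => hf (measurableSet_singleton e)
  have := sum_measureReal_preimage_singleton (μ := (P₁.prod μU).restrict B) Finset.univ
    (f := histF Z m ∘ Prod.fst) (fun e _ => hmeas e)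
  rw [Finset.coe_univ, Set.preimage_univ, measureReal_restrict_apply_univ] at this
  rw [← this]
  refine Finset.sum_congr rfl (fun e _ => ?_)
  rw [measureReal_restrict_apply (hmeas e), Set.inter_comm]
  rfl

/-- **The coupled field has product finite-dimensional marginals**:
`P(⋂_{n ∈ G} V_n) = ∏_{n ∈ G} ρ_n`. [cite: LiggettSchonmannStacey1997, Lemma 1.1] -/
theorem real_iInter_V [IsProbabilityMeasure P₁] (hZ : ∀ i, MeasurableSet (Z i)) (hρ : ∀ n, 0 ≤ ρ n)
    (hdom : ∀ n e, ρ n * P₁.real (atomF Z n e) ≤ P₁.real (Z n ∩ atomF Z n e))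
    (G : Finset ℕ) : (P₁.prod μU).real (⋂ n ∈ G, V P₁ Z ρ n) = ∏ n ∈ G, ρ n := by
  classical
  induction G using Finset.induction_on_max with
  | empty => simp
  | insert m G hG ih =>
    have hmG : m ∉ G := fun h => lt_irrefl _ (hG m h)
    rw [Finset.prod_insert hmG, ← ih, real_eq_sum_atomF hZ m,
      real_eq_sum_atomF hZ m (B := ⋂ n ∈ G, V P₁ Z ρ n), Finset.mul_sum]
    exact Finset.sum_congr rfl (fun e _ => real_iInter_V_inter_atom hρ hdom hG e)

/-- **LSS Lemma 1.1 (sequential coupling ⇒ domination of a product field)**, in the form: if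
`P(Z_n ∩ A) ≥ P'(Y_n) P(A)` for every history atom `A` of `Z_0,…,Z_{n-1}`, and the `Y_n` are
independent, then the random set `{n | Z_n}` dominates `{n | Y_n}` on increasing events.
[cite: LiggettSchonmannStacey1997, Lemma 1.1] -/
theorem seqCoupling [IsProbabilityMeasure P₁] {Ω' : Type*} [MeasurableSpace Ω'] (P' : Measure Ω')
    [IsProbabilityMeasure P'] (hZ : ∀ n, MeasurableSet (Z n)) (Y : ℕ → Set Ω')
    (hY : ∀ n, MeasurableSet (Y n))
    (hYprod : ∀ G : Finset ℕ, P' (⋂ n ∈ G, Y n) = ∏ n ∈ G, P' (Y n))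
    (hdom : ∀ n e, P'.real (Y n) * P₁.real (atomF Z n e) ≤ P₁.real (Z n ∩ atomF Z n e))
    (E : Set (Set ℕ)) (hE : IsUpperSet E) (hEm : MeasurableSet E) :
    P'.real {ω' | {n | ω' ∈ Y n} ∈ E} ≤ P₁.real {ω | {n | ω ∈ Z n} ∈ E} := by
  set ρ : ℕ → ℝ := fun n => P'.real (Y n) with hρdef
  have hρ : ∀ n, 0 ≤ ρ n := fun n => measureReal_nonneg
  set P₂ := P₁.prod μU with hP₂
  -- the two random sets
  set SY : Ω' → Set ℕ := fun ω' => {n | ω' ∈ Y n} with hSY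
  set SV : Ω₁ × (ℕ → ℝ) → Set ℕ := fun p => {n | p ∈ V P₁ Z ρ n} with hSV
  have mSY : Measurable SY := measurable_set_iff.2 fun n => measurableSet_setOf.1 (hY n)
  have mSV : Measurable SV :=
    measurable_set_iff.2 fun n => measurableSet_setOf.1 (measurableSet_V hZ n)
  -- their laws agree
  have hlaw : P'.map SY = P₂.map SV := by
    classical
    have : IsProbabilityMeasure (P'.map SY) := Measure.isProbabilityMeasure_map mSY.aemeasurable
    have : IsProbabilityMeasure (P₂.map SV) := Measure.isProbabilityMeasure_map mSV.aemeasurable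
    refine measure_set_ext (fun G => ?_)
    have hGm : MeasurableSet {s : Set ℕ | ↑G ⊆ s} := measurableSet_supsets ⟨G, rfl⟩
    rw [Measure.map_apply mSY hGm, Measure.map_apply mSV hGm]
    have h1 : SY ⁻¹' {s : Set ℕ | ↑G ⊆ s} = ⋂ n ∈ G, Y n := by
      ext ω'; simp [hSY, Set.subset_def]
    have h2 : SV ⁻¹' {s : Set ℕ | ↑G ⊆ s} = ⋂ n ∈ G, V P₁ Z ρ n := by
      ext p; simp [hSV, Set.subset_def]
    rw [h1, h2, hYprod]
    have h3 : P₂.real (⋂ n ∈ G, V P₁ Z ρ n) = ∏ n ∈ G, ρ n := real_iInter_V hZ hρ hdom G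
    rw [measureReal_def] at h3
    rw [← ENNReal.ofReal_toReal (measure_ne_top P₂ _), h3, ENNReal.ofReal_prod_of_nonneg
      (fun n _ => hρ n)]
    refine Finset.prod_congr rfl (fun n _ => ?_)
    change P' (Y n) = ENNReal.ofReal (P'.real (Y n))
    rw [measureReal_def, ENNReal.ofReal_toReal (measure_ne_top P' _)]
  -- conclusion
  have hV_sub : ∀ p : Ω₁ × (ℕ → ℝ), SV p ⊆ {n | p.1 ∈ Z n} := fun p n hn => hn.1
  calc P'.real {ω' | {n | ω' ∈ Y n} ∈ E} = (P'.map SY).real E := by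
        rw [map_measureReal_apply mSY hEm]; rfl
    _ = (P₂.map SV).real E := by rw [hlaw]
    _ = P₂.real (SV ⁻¹' E) := map_measureReal_apply mSV hEm
    _ ≤ P₂.real (Prod.fst ⁻¹' {ω | {n | ω ∈ Z n} ∈ E}) :=
        measureReal_mono (fun p hp => hE (hV_sub p) hp)
    _ = P₁.real {ω | {n | ω ∈ Z n} ∈ E} := by
        rw [← Set.prod_univ, measureReal_prod_prod, probReal_univ, mul_one]

end SeqCoupling


/-! ## Theorem 1.3 of Liggett–Schonmann–Stacey on `ℕ` with an abstract dependence graph -/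

section Nat

variable {Ω : Type*}

/-- History atoms are atoms over `Finset.range n` of the extended pattern. [folklore] -/
theorem atomF_eq_atom (Z : ℕ → Set Ω) (n : ℕ) (e : Fin n → Bool) :
    atomF Z n e = atom Z (Finset.range n) (extF e) := by
  ext ω
  rw [mem_atomF, mem_atom]
  constructor
  · intro h i hi
    rw [Finset.mem_range] at hi
    simpa [extF, hi] using h ⟨i, hi⟩
  · intro h i
    simpa [extF, i.2] using h i.1 (Finset.mem_range.2 i.2)

/-- Atoms of measurable events are measurable. [folklore] -/
theorem measurableSet_atom_prodσ (m : MeasurableSpace Ω) (X : ℕ → Set Ω)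
    {F : Finset ℕ} (hX : ∀ i ∈ F, MeasurableSet[m] (X i)) (r : ℝ) (ε : ℕ → Bool) :
    MeasurableSet[prodσ m F]
      (atom (fun i => (Prod.fst ⁻¹' X i) ∩ {p : Ω × (ℕ → ℝ) | p.2 i < r}) F ε) := by
  refine @MeasurableSet.biInter _ _ (prodσ m F) _ _ F.countable_toSet (fun i hi => ?_)
  have hZ : MeasurableSet[prodσ m F] ((Prod.fst ⁻¹' X i) ∩ {p : Ω × (ℕ → ℝ) | p.2 i < r}) :=
    @MeasurableSet.inter _ (prodσ m F) _ _ (measurableSet_prodσ_fst F (hX i hi))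
      (measurableSet_prodσ_snd m hi measurableSet_Iio)
  split_ifs
  · exact hZ
  · exact @MeasurableSet.compl _ _ (prodσ m F) hZ

/-- **LSS Theorem 1.3 (qualitative form) on `ℕ`.** Events `X_n` with a dependence neighbourhood
`bad n` of size `≤ Δ` (outside which `X_n` is independent of the others), failure probabilities
`≤ q ≤ (1-α) min(αr,1-r)^Δ`; then `{n | X_n}` dominates every independent family with marginals
`≤ αr` on increasing events. Proof: Prop 1.2 for `Z_n = X_n ∧ U_n < r` on `Ω × [0,1]^ℕ`, then
Lemma 1.1. [cite: LiggettSchonmannStacey1997, Thm 1.3, Prop 1.2, Lemma 1.1] -/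
theorem lss_nat {Ω' : Type*} [mΩ : MeasurableSpace Ω] [MeasurableSpace Ω'] (P : Measure Ω)
    (P' : Measure Ω') [IsProbabilityMeasure P] [IsProbabilityMeasure P'] (X : ℕ → Set Ω)
    (Y : ℕ → Set Ω') (hX : ∀ n, MeasurableSet (X n)) (hY : ∀ n, MeasurableSet (Y n))
    (bad : ℕ → Finset ℕ) {Δ : ℕ} (hcard : ∀ n, (bad n).card ≤ Δ)
    (hind : ∀ n (F : Finset ℕ), Disjoint (bad n) F → n ∉ F →
      Indep (generateFrom {X n}) (generateFrom (X '' ↑F)) P)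
    {q α r : ℝ} (hα1 : α ≤ 1) (hr0 : 0 < r) (hr1 : r < 1) (hc0 : 0 ≤ min (α * r) (1 - r))
    (hq : q ≤ (1 - α) * (min (α * r) (1 - r)) ^ Δ)
    (hmarg : ∀ n, P.real (X n)ᶜ ≤ q)
    (hYprod : ∀ G : Finset ℕ, P' (⋂ n ∈ G, Y n) = ∏ n ∈ G, P' (Y n))
    (hYmarg : ∀ n, P'.real (Y n) ≤ α * r)
    (E : Set (Set ℕ)) (hE : IsUpperSet E) (hEm : MeasurableSet E) :
    P'.real {ω' | {n | ω' ∈ Y n} ∈ E} ≤ P.real {ω | {n | ω ∈ X n} ∈ E} := by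
  classical
  -- the enlarged space and the thinned events `Z_n = X_n ∧ U_n < r`
  set P₁ : Measure (Ω × (ℕ → ℝ)) := P.prod μU with hP₁
  set X' : ℕ → Set (Ω × (ℕ → ℝ)) := fun n => Prod.fst ⁻¹' X n with hX'
  set Yev : ℕ → Set (Ω × (ℕ → ℝ)) := fun n => {p | p.2 n < r} with hYev
  set Z : ℕ → Set (Ω × (ℕ → ℝ)) := fun n => X' n ∩ Yev n with hZdef
  have hX'm : ∀ n, MeasurableSet (X' n) := fun n => (hX n).preimage measurable_fst
  have hYevm : ∀ n, MeasurableSet (Yev n) := fun n =>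
    measurableSet_lt ((measurable_pi_apply n).comp measurable_snd) measurable_const
  have hZm : ∀ n, MeasurableSet (Z n) := fun n => (hX'm n).inter (hYevm n)
  -- measure of `Yev m`
  have hYev_real : ∀ m, P₁.real (Yev m) = r := by
    intro m
    have hset : Yev m = (Set.univ : Set Ω) ×ˢ {u : ℕ → ℝ | ∀ i ∈ ({m} : Finset ℕ), u i < r} := by
      ext p; simp [hYev]
    rw [hset, measureReal_prod_prod, probReal_univ, one_mul, measureReal_def,
      μU_setOf_lt {m} (fun _ => r) (fun _ _ => hr0.le) (fun _ _ => hr1.le),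
      ENNReal.toReal_ofReal (Finset.prod_nonneg fun _ _ => hr0.le)]
    simp
  -- (h2)/(h3): `Yev m` is independent of everything else
  have hYev_indep : ∀ m (F : Finset ℕ), m ∉ F → ∀ D : Set (Ω × (ℕ → ℝ)),
      MeasurableSet[prodσ mΩ F] D → P₁.real (Yev m ∩ D) = r * P₁.real D := by
    intro m F hmF D hD
    have hI : Indep (prodσ (⊥ : MeasurableSpace Ω) {m}) (prodσ mΩ F) P₁ :=
      indep_prodσ bot_le le_rfl (indep_bot_left _) (Finset.disjoint_singleton_left.2 hmF)
    have hYm : MeasurableSet[prodσ (⊥ : MeasurableSpace Ω) {m}] (Yev m) :=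
      measurableSet_prodσ_snd ⊥ (Finset.mem_singleton_self m) measurableSet_Iio
    have := (Indep_iff _ _ _).1 hI _ _ hYm hD
    rw [measureReal_def, this, ENNReal.toReal_mul, ← measureReal_def, ← measureReal_def,
      hYev_real]
  have h2 : ∀ m F, m ∉ F → ∀ ε,
      P₁.real (Yev m ∩ (X' m ∩ atom Z F ε)) = r * P₁.real (X' m ∩ atom Z F ε) := by
    intro m F hmF ε
    refine hYev_indep m F hmF _ ?_
    exact @MeasurableSet.inter _ (prodσ mΩ F) _ _ (measurableSet_prodσ_fst F (hX m))
      (measurableSet_atom_prodσ mΩ X (fun i _ => hX i) r ε)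
  have h3 : ∀ m F, m ∉ F → ∀ ε, P₁.real (Yev m ∩ atom Z F ε) = r * P₁.real (atom Z F ε) := by
    intro m F hmF ε
    exact hYev_indep m F hmF _ (measurableSet_atom_prodσ mΩ X (fun i _ => hX i) r ε)
  -- (h1): outside its neighbourhood, `X_n` fails with conditional probability `≤ q`
  have h1 : ∀ n F, Disjoint (bad n) F → n ∉ F → ∀ ε,
      P₁.real ((X' n)ᶜ ∩ atom Z F ε) ≤ q * P₁.real (atom Z F ε) := by
    intro n F hdisj hnF ε
    have hle1 : generateFrom {X n} ≤ mΩ :=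
      generateFrom_le (fun s hs => by rw [Set.mem_singleton_iff.1 hs]; exact hX n)
    have hle2 : generateFrom (X '' ↑F) ≤ mΩ :=
      generateFrom_le (fun s hs => by obtain ⟨i, -, rfl⟩ := hs; exact hX i)
    have hI : Indep (prodσ (generateFrom {X n}) ∅) (prodσ (generateFrom (X '' ↑F)) F) P₁ :=
      indep_prodσ hle1 hle2 (hind n F hdisj hnF) (Finset.disjoint_empty_left F)
    have hA : MeasurableSet[prodσ (generateFrom {X n}) ∅] (X' n)ᶜ :=
      @MeasurableSet.compl _ _ (prodσ (generateFrom {X n}) ∅)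
        (measurableSet_prodσ_fst ∅ (measurableSet_generateFrom rfl))
    have hB : MeasurableSet[prodσ (generateFrom (X '' ↑F)) F] (atom Z F ε) :=
      measurableSet_atom_prodσ (generateFrom (X '' ↑F)) X
        (fun i hi => measurableSet_generateFrom ⟨i, hi, rfl⟩) r ε
    have := (Indep_iff _ _ _).1 hI _ _ hA hB
    have hXn : P₁.real (X' n)ᶜ = P.real (X n)ᶜ := by
      have hset : (X' n)ᶜ = (X n)ᶜ ×ˢ (Set.univ : Set (ℕ → ℝ)) := by
        rw [Set.prod_univ]; rfl
      rw [hset, measureReal_prod_prod, probReal_univ, mul_one]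
    rw [measureReal_def, this, ENNReal.toReal_mul, ← measureReal_def, ← measureReal_def, hXn]
    exact mul_le_mul_of_nonneg_right (hmarg n) measureReal_nonneg
  -- Proposition 1.2
  have hP12 := prop12 P₁ hX'm hYevm (fun n => rfl) bad hcard hα1 hr0.le hq h1 h2 h3 hc0
  -- the hypothesis of Lemma 1.1 for `Z`
  have hdom : ∀ n (e : Fin n → Bool),
      P'.real (Y n) * P₁.real (atomF Z n e) ≤ P₁.real (Z n ∩ atomF Z n e) := by
    intro n e
    rw [atomF_eq_atom]
    have hn : n ∉ Finset.range n := by simp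
    have hb := hP12 (Finset.range n) n hn (extF e)
    have hge := real_Z_inter_ge P₁ (hX'm n) hr0.le (h2 n _ hn (extF e)) hb
    exact (mul_le_mul_of_nonneg_right (hYmarg n) measureReal_nonneg).trans hge
  -- Lemma 1.1
  have hdomE := seqCoupling (P₁ := P₁) (Z := Z) P' hZm Y hY hYprod hdom E hE hEm
  refine hdomE.trans ?_
  calc P₁.real {p | {n | p ∈ Z n} ∈ E}
      ≤ P₁.real (Prod.fst ⁻¹' {ω | {n | ω ∈ X n} ∈ E}) :=
        measureReal_mono (fun p hp => hE (fun n hn => hn.1) hp)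
    _ = P.real {ω | {n | ω ∈ X n} ∈ E} := by
        rw [← Set.prod_univ, measureReal_prod_prod, probReal_univ, mul_one]

end Nat

/-! ## Transfer to `ℤ^d` -/

section Transfer

variable {d : ℕ}

/-- The `ℓ^∞`-ball of radius `M` around `x` in `ℤ^d`, as a `Finset`. [folklore] -/
def nbhd (M : ℕ) (x : Fin d → ℤ) : Finset (Fin d → ℤ) :=
  Fintype.piFinset fun i => Finset.Icc (x i - M) (x i + M)

/-- Sites at `ℓ^∞`-distance `≤ M` from `x` lie in `nbhd M x` (`dist` on `Fin d → ℤ` is the sup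
metric, `Int.dist_eq`). [folklore] -/
theorem mem_nbhd_of_dist_le {M : ℕ} {x b : Fin d → ℤ} (h : dist x b ≤ M) : b ∈ nbhd M x := by
  rw [nbhd, Fintype.mem_piFinset]
  intro i
  have hi : dist (x i) (b i) ≤ M := (dist_pi_le_iff (by positivity)).1 h i
  rw [Int.dist_eq] at hi
  have hi' : |x i - b i| ≤ (M : ℤ) := by exact_mod_cast hi
  rw [abs_le] at hi'
  rw [Finset.mem_Icc]
  constructor <;> omega

/-- `#nbhd M x = (2M+1)^d`. [folklore] -/
theorem card_nbhd (M : ℕ) (x : Fin d → ℤ) : (nbhd M x).card = (2 * M + 1) ^ d := by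
  rw [nbhd, Fintype.card_piFinset]
  simp only [Int.card_Icc]
  have : ∀ i : Fin d, (x i + ↑M + 1 - (x i - ↑M)).toNat = 2 * M + 1 := fun i => by omega
  simp [this]

end Transfer

end LSS

/-! ## The proof of the named fact -/

open _root_.MeasureTheory _root_.ProbabilityTheory MeasurableSpace LSS in
/-- **Liggett–Schonmann–Stacey 1997, Theorem 0.0 (i)–(ii)**, corollary form: discharge of
`LiggettSchonmannStacey1997_dominatesProduct`. Parameters: `ρ₀ = max ρ ½`, `r = (1+ρ₀)/2`,
`α = ρ₀/r`, `Δ = (2M+1)^d`, `δ = (1-α) min(ρ₀, 1-r)^Δ`; the `ℤ^d`-indexed families are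
re-indexed by `ℕ` along an injection (padding with sure / impossible events) and `lss_nat`
applies. [cite: LiggettSchonmannStacey1997, Thm 0.0, Thm 1.3, Cor 1.4] -/
theorem LiggettSchonmannStacey1997_dominatesProduct_holds :
    LiggettSchonmannStacey1997_dominatesProduct := by
  classical
  intro d M ρ hρ1
  -- parameters
  set ρ₀ : ℝ := max ρ (1 / 2) with hρ₀
  have hρ₀0 : 0 < ρ₀ := lt_max_of_lt_right (by norm_num)
  have hρ₀1 : ρ₀ < 1 := max_lt hρ1 (by norm_num)
  have hρρ₀ : ρ ≤ ρ₀ := le_max_left _ _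
  set r : ℝ := (1 + ρ₀) / 2 with hr
  have hr0 : 0 < r := by rw [hr]; linarith
  have hr1 : r < 1 := by rw [hr]; linarith
  have hρ₀r : ρ₀ < r := by rw [hr]; linarith
  set α : ℝ := ρ₀ / r with hα
  have hα1 : α < 1 := (div_lt_one hr0).2 hρ₀r
  have hαr : α * r = ρ₀ := div_mul_cancel₀ _ hr0.ne'
  set Δ : ℕ := (2 * M + 1) ^ d with hΔ
  have hc0 : 0 < min (α * r) (1 - r) := lt_min (by rw [hαr]; exact hρ₀0) (by linarith)
  refine ⟨(1 - α) * (min (α * r) (1 - r)) ^ Δ, mul_pos (by linarith) (pow_pos hc0 Δ), ?_⟩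
  intro Ω Ω' _ _ P P' _ _ X Y hXm hYm hdep hXmarg hYind hYmarg E hE hEm
  -- re-index by `ℕ`
  obtain ⟨enc, henc⟩ := Countable.exists_injective_nat (Fin d → ℤ)
  set Xh : ℕ → Set Ω := Function.extend enc X (fun _ => Set.univ) with hXh
  set Yh : ℕ → Set Ω' := Function.extend enc Y (fun _ => ∅) with hYh
  set bad : ℕ → Finset ℕ := Function.extend enc (fun x => (nbhd M x).image enc) (fun _ => ∅)
    with hbad
  have hXh_enc : ∀ x, Xh (enc x) = X x := fun x => henc.extend_apply _ _ x
  have hYh_enc : ∀ x, Yh (enc x) = Y x := fun x => henc.extend_apply _ _ x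
  have hbad_enc : ∀ x, bad (enc x) = (nbhd M x).image enc := fun x => henc.extend_apply _ _ x
  have hXh_out : ∀ n, (¬ ∃ x, enc x = n) → Xh n = Set.univ :=
    fun n hn => Function.extend_apply' _ _ _ hn
  have hYh_out : ∀ n, (¬ ∃ x, enc x = n) → Yh n = ∅ :=
    fun n hn => Function.extend_apply' _ _ _ hn
  have hbad_out : ∀ n, (¬ ∃ x, enc x = n) → bad n = ∅ :=
    fun n hn => Function.extend_apply' _ _ _ hn
  have hXhm : ∀ n, MeasurableSet (Xh n) := by
    intro n
    by_cases hn : ∃ x, enc x = n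
    · obtain ⟨x, rfl⟩ := hn; rw [hXh_enc]; exact hXm x
    · rw [hXh_out n hn]; exact MeasurableSet.univ
  have hYhm : ∀ n, MeasurableSet (Yh n) := by
    intro n
    by_cases hn : ∃ x, enc x = n
    · obtain ⟨x, rfl⟩ := hn; rw [hYh_enc]; exact hYm x
    · rw [hYh_out n hn]; exact MeasurableSet.empty
  -- size of neighbourhoods
  have hcard : ∀ n, (bad n).card ≤ Δ := by
    intro n
    by_cases hn : ∃ x, enc x = n
    · obtain ⟨x, rfl⟩ := hn
      rw [hbad_enc]
      exact Finset.card_image_le.trans (card_nbhd M x).le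
    · rw [hbad_out n hn]; simp
  -- dependence structure
  have hind : ∀ n (F : Finset ℕ), Disjoint (bad n) F → n ∉ F →
      Indep (generateFrom {Xh n}) (generateFrom (Xh '' ↑F)) P := by
    intro n F hdisj hnF
    by_cases hn : ∃ x, enc x = n
    · obtain ⟨x, rfl⟩ := hn
      set B : Set (Fin d → ℤ) := {y | enc y ∈ F} with hB
      have hfar : ∀ a ∈ ({x} : Set (Fin d → ℤ)), ∀ b ∈ B, (M : ℝ) < dist a b := by
        intro a ha b hb
        rw [Set.mem_singleton_iff] at ha
        subst ha
        by_contra hle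
        push Not at hle
        have hb' : enc b ∈ bad (enc a) := by
          rw [hbad_enc]; exact Finset.mem_image_of_mem _ (mem_nbhd_of_dist_le hle)
        exact Finset.disjoint_left.1 hdisj hb' hb
      have hI := hdep {x} B hfar
      rw [Set.image_singleton, ← hXh_enc] at hI
      refine indep_of_indep_of_le_right hI (generateFrom_le ?_)
      rintro s ⟨k, hk, rfl⟩
      by_cases hk' : ∃ y, enc y = k
      · obtain ⟨y, rfl⟩ := hk'
        rw [hXh_enc]
        exact measurableSet_generateFrom ⟨y, hk, rfl⟩
      · rw [hXh_out k hk']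
        exact MeasurableSet.univ
    · rw [hXh_out n hn, generateFrom_singleton_univ]
      exact indep_bot_left _
  -- marginals of `Xh`
  have hmarg : ∀ n, P.real (Xh n)ᶜ ≤ (1 - α) * (min (α * r) (1 - r)) ^ Δ := by
    intro n
    by_cases hn : ∃ x, enc x = n
    · obtain ⟨x, rfl⟩ := hn
      rw [hXh_enc, measureReal_compl (hXm x), probReal_univ]
      linarith [hXmarg x]
    · rw [hXh_out n hn, Set.compl_univ, measureReal_empty]
      exact (mul_pos (by linarith) (pow_pos hc0 Δ)).le
  -- product structure and marginals of `Yh`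
  have hYprod : ∀ G : Finset ℕ, P' (⋂ n ∈ G, Yh n) = ∏ n ∈ G, P' (Yh n) := by
    intro G
    by_cases hG : ∀ n ∈ G, ∃ x, enc x = n
    · set H : Finset (Fin d → ℤ) := G.preimage enc (henc.injOn) with hH
      have hGH : G = H.image enc := by
        rw [hH, Finset.image_preimage]
        ext n
        simp only [Finset.mem_filter, Set.mem_range]
        exact ⟨fun h => ⟨h, by obtain ⟨x, hx⟩ := hG n h; exact ⟨x, hx⟩⟩, fun h => h.1⟩
      rw [hGH, Finset.set_biInter_finset_image, Finset.prod_image (fun a _ b _ h => henc h)]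
      simp_rw [hYh_enc]
      exact hYind.meas_biInter H
    · push Not at hG
      obtain ⟨n, hn, hn'⟩ := hG
      have h0 : Yh n = ∅ := hYh_out n (fun ⟨x, hx⟩ => hn' x hx)
      rw [Finset.prod_eq_zero hn (by rw [h0, measure_empty])]
      refine le_antisymm ?_ bot_le
      calc P' (⋂ k ∈ G, Yh k) ≤ P' (Yh n) := measure_mono (Set.biInter_subset_of_mem hn)
        _ = 0 := by rw [h0, measure_empty]
  have hYmarg' : ∀ n, P'.real (Yh n) ≤ α * r := by
    intro n
    rw [hαr]
    by_cases hn : ∃ x, enc x = n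
    · obtain ⟨x, rfl⟩ := hn; rw [hYh_enc]; exact (hYmarg x).trans hρρ₀
    · rw [hYh_out n hn, measureReal_empty]; exact hρ₀0.le
  -- the transported event
  set Eh : Set (Set ℕ) := {s | enc ⁻¹' s ∈ E} with hEh
  have hEh_up : IsUpperSet Eh := fun s t hst hs => hE (Set.preimage_mono hst) hs
  have hEh_m : MeasurableSet Eh := by
    have : Measurable fun s : Set ℕ => enc ⁻¹' s :=
      measurable_set_iff.2 fun x => measurable_set_mem (enc x)
    exact this hEm
  have key := lss_nat P P' Xh Yh hXhm hYhm bad hcard hind hα1.le hr0 hr1 hc0.le le_rfl hmarg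
    hYprod hYmarg' Eh hEh_up hEh_m
  have hYset : {ω' | {n | ω' ∈ Yh n} ∈ Eh} = {ω' | {x | ω' ∈ Y x} ∈ E} := by
    ext ω'
    simp only [hEh, Set.mem_setOf_eq, Set.preimage_setOf_eq, hYh_enc]
  have hXset : {ω | {n | ω ∈ Xh n} ∈ Eh} = {ω | {x | ω ∈ X x} ∈ E} := by
    ext ω
    simp only [hEh, Set.mem_setOf_eq, Set.preimage_setOf_eq, hXh_enc]
  rw [hYset, hXset] at key
  exact key

end Literature.Probability.Percolation
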